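import Summits.QuantumFields.YangMills.Theorems.UniversalDetectorTightPeelingPrep
import Summits.QuantumFields.YangMills.Theses.UniversalDetector
import HarnessLib

/-!
# Route `UniversalDetector`, LINE g9-3 «Hölder-gradient peeling» — the glue item `TightPeelingGlue`

Ideator seat ym-idea-8 (generation 9, lens «dual»).  Proof of the glue item
`Summit.QuantumFields.YangMills.Theses.UniversalDetector.TightPeelingGlue` (stmt-QuantumFields-23935) of the split of the
deciding crux `PlaneTightScheme` (stmt-QuantumFields-23250):
`SchemeResponseLaws → TwoCubePeeling → PlaneTightScheme`.

At the scheme `(r, a)` of `SchemeResponseLaws`, fix orientations `q₁, q₂`, a mesoscopic floor `η > 0`, and put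
`c = min(η/16, min(ℓ₁, ℓ₂)/2)`, `N(β) = ⌊c / a(β)⌋₊` (so `c/2 ≤ N a ≤ c`, `N ≥ 2` once `a(β) ≤ min(η/48, c/2)`).
For a box point `z` off the ball (`η ≤ ‖a z‖`) some coordinate has `|z_{j₀}| ≥ 2N+6` and the torus is large
(`4N+8 ≤ L`); centring the pair `(0, z)` by the translation `m = z/2` puts both cubes of radius `N` in the window,
`2N+6` apart (`…Prep.halving_geometry`).  Then

* BOUNDEDNESS: `|ker6(z)| = a⁻⁸|Cov_T(P_{q₁}(0), P_{q₂}(z))| ≤ a⁻⁸ · 4e^B C₁²/N⁸ ≤ 4e^B C₁² (2/c)⁸` — (RM₁) peeled on both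
  cubes (`abs_torusCov_plane_le_of_expMoments`);
* EQUICONTINUITY: for `z' = z + u` with `t = ‖a(z − z')‖ ≤ c/8`, `n = ⌈‖u‖⌉ ≤ N/2` and
  `|ker6(z) − ker6(z')| = a⁻⁸|Cov_T(P_{q₁}(−m), P_{q₂}(z−m) − P_{q₂}(z−m+u))| ≤ 2√(2e^B)C₁√(2e^{B₂})C₂ (2/c)⁸ (4t/c)^γ`
  — (RM₁) ⊗ (RMH) peeled (`…Prep.abs_torusCov_plane_sub_le_of_expMoments`), the Hölder gain `(n/N)^γ ≤ (4t/c)^γ`;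
  for `t > c/8` the bound `2 C_bd`; the modulus `ω(t) = C_ω (4t/c)^γ · 1_{t ≤ c/8} + 2C_bd · 1_{t > c/8}` tends to `0`
  at `0⁺`;
* NONCONTACT is carried verbatim.

(The hypothesis `TwoCubePeeling` enters through its landed proof `twoCube_peel`.)  HONEST FRAMING: this proves a glue
item of a sub-line; the cruxes (RM₁, RMH = the spine's E0′-K wall; NONCONTACT = the non-perturbative bit) stay open; no
summit is proved by this line; not Clay.
-/

set_option autoImplicit false

noncomputable section

/-! ## §4 The glue: TIGHT6 from (RM₁) + (RMH) by two-cube peeling -/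

namespace Summit.QuantumFields.YangMills.Cruxes.UniversalDetectorTightPeeling

open MeasureTheory Filter Topology
open Literature.MathematicalPhysics.QuantumFieldTheory Literature.MathematicalPhysics.QuantumLattice
open Literature.Probability.LatticeModels
open Summit.QuantumFields.YangMills.Cruxes.OSLegsFromFemtoAndGap.DlrCollarTransfer
open Summit.QuantumFields.YangMills.Cruxes.NT.Reference (eventually_le_of_tendsto)
open Summit.QuantumFields.YangMills.Cruxes.UniversalDetectorPlaneTight (cov_plane_translate)
open Summit.QuantumFields.YangMills.Cruxes.FiniteRankMirrorPeeling (abs_torusCov_plane_le_of_expMoments)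

section Core

variable (G : Type) [Group G] [TopologicalSpace G] [IsTopologicalGroup G] [CompactSpace G]
  [MeasurableSpace G] [BorelSpace G] (r : LatticeRep G)

/-- **Centred pair bound.**  On the odd torus `2L+1` with `2N+12 ≤ L`, `N ≥ 1`: if every plaquette obeys (RM₁) at radius
`N` (at the coupling and torus at hand), then for `z` in the box with a coordinate `|z j₀| ≥ 2N+6`,
`|Cov_T(P_{q₁}(0), P_{q₂}(z))| ≤ 4e^B C₁²/N⁸` (translate by `z/2`, peel both cubes). [folklore] -/
theorem abs_cov_plane_zero_le {β : ℝ} {L N : ℕ} (hN : 1 ≤ N) (hL : 2 * N + 12 ≤ L) {C₁ B : ℝ} (hC₁ : 0 < C₁)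
    {pr : Fin 4 × Fin 4 → ℝ}
    (hRM : ∀ (q : Fin 4 × Fin 4) (x : Fin 4 → ℤ), q.1 < q.2 → torusE G r β L (fun U => Real.exp ((N : ℝ) ^ 4 / C₁ *
        |kerE G r β (fun k => x k - ((N : ℤ) + 1)) (2 * N + 3) U (plane G r q x) - pr q|)) ≤ Real.exp B)
    {q₁ q₂ : Fin 4 × Fin 4} (hq₁ : q₁.1 < q₁.2) (hq₂ : q₂.1 < q₂.2)
    {z : Fin 4 → ℤ} (hz : ∀ j, -(L : ℤ) ≤ z j ∧ z j ≤ L) {j₀ : Fin 4} (hj₀ : 2 * (N : ℤ) + 6 ≤ |z j₀|) :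
    |torusE G r β L (fun U => plane G r q₁ 0 U * plane G r q₂ z U) -
        torusE G r β L (plane G r q₁ 0) * torusE G r β L (plane G r q₂ z)| ≤ 4 * Real.exp B * C₁ ^ 2 / (N : ℝ) ^ 8 := by
  obtain ⟨hw₁, hw₂, hsep⟩ := halving_geometry hz hL hj₀
  have htr := cov_plane_translate r β L q₁ q₂ (-(fun k => z k / 2)) (z - fun k => z k / 2)
  rw [show (z - fun k => z k / 2) - -(fun k => z k / 2) = z by abel] at htr
  rw [← htr]
  exact abs_torusCov_plane_le_of_expMoments G r hN q₁ q₂ _ _ hw₁ hw₂ hsep hC₁ (hRM q₁ _ hq₁) (hRM q₂ _ hq₂)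

/-- **Centred increment bound.**  Same setting, plus (RMH) at radius `N` for increments `u` with `|u j| ≤ n`, `2n ≤ N`, rate
`λ₂`: `|Cov_T(P_{q₁}(0), P_{q₂}(z)) − Cov_T(P_{q₁}(0), P_{q₂}(z+u))| ≤ 2 (√(2e^B) C₁/N⁴)(√(2e^{B₂})/λ₂)`. [folklore] -/
theorem abs_cov_plane_zero_sub_le {β : ℝ} {L N n : ℕ} (hN : 1 ≤ N) (hn : n ≤ N) (hL : 2 * N + 12 ≤ L)
    {C₁ B B₂ lam₂ : ℝ} (hC₁ : 0 < C₁) (hlam₂ : 0 < lam₂) {pr : Fin 4 × Fin 4 → ℝ} {u : Fin 4 → ℤ}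
    (hu : ∀ j, |u j| ≤ (n : ℤ))
    (hRM : ∀ (q : Fin 4 × Fin 4) (x : Fin 4 → ℤ), q.1 < q.2 → torusE G r β L (fun U => Real.exp ((N : ℝ) ^ 4 / C₁ *
        |kerE G r β (fun k => x k - ((N : ℤ) + 1)) (2 * N + 3) U (plane G r q x) - pr q|)) ≤ Real.exp B)
    (hRMH : ∀ (q : Fin 4 × Fin 4) (x : Fin 4 → ℤ), q.1 < q.2 → torusE G r β L (fun U => Real.exp (lam₂ *
        |kerE G r β (fun k => x k - ((N : ℤ) + 1)) (2 * N + 3) U (fun V => plane G r q x V - plane G r q (x + u) V)|))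
        ≤ Real.exp B₂)
    {q₁ q₂ : Fin 4 × Fin 4} (hq₁ : q₁.1 < q₁.2) (hq₂ : q₂.1 < q₂.2)
    {z : Fin 4 → ℤ} (hz : ∀ j, -(L : ℤ) ≤ z j ∧ z j ≤ L) {j₀ : Fin 4} (hj₀ : 2 * (N : ℤ) + 6 ≤ |z j₀|) :
    |(torusE G r β L (fun U => plane G r q₁ 0 U * plane G r q₂ z U) -
          torusE G r β L (plane G r q₁ 0) * torusE G r β L (plane G r q₂ z)) -
        (torusE G r β L (fun U => plane G r q₁ 0 U * plane G r q₂ (z + u) U) -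
          torusE G r β L (plane G r q₁ 0) * torusE G r β L (plane G r q₂ (z + u)))| ≤
      2 * (Real.sqrt (2 * Real.exp B) * C₁ / (N : ℝ) ^ 4) * (Real.sqrt (2 * Real.exp B₂) / lam₂) := by
  obtain ⟨hw₁, hw₂, hsep⟩ := halving_geometry hz hL hj₀
  have htr₁ := cov_plane_translate r β L q₁ q₂ (-(fun k => z k / 2)) (z - fun k => z k / 2)
  rw [show (z - fun k => z k / 2) - -(fun k => z k / 2) = z by abel] at htr₁
  have htr₂ := cov_plane_translate r β L q₁ q₂ (-(fun k => z k / 2)) ((z - fun k => z k / 2) + u)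
  rw [show (z - fun k => z k / 2) + u - -(fun k => z k / 2) = z + u by abel] at htr₂
  rw [← htr₁, ← htr₂, torusCov_sub_right G r β L (continuous_plane r q₁ _) (continuous_plane r q₂ _)
    (continuous_plane r q₂ _)]
  exact abs_torusCov_plane_sub_le_of_expMoments G r hN hn q₁ q₂ _ _ u hu hw₁ hw₂ hsep hC₁ hlam₂
    (hRM q₁ _ hq₁) (hRMH q₂ _ hq₂)

end Core

/-! ## §5 The glue item -/

/-- **TIGHT6 from one-point response laws** (glue item `TightPeelingGlue`): `SchemeResponseLaws → TwoCubePeeling →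
PlaneTightScheme`.  At the scheme `(r, a)` of `SchemeResponseLaws`: BOUNDEDNESS of the normalised plane-resolved kernels
off the ball of radius `η` from (RM₁) peeled on both cubes of radius `N(β) = ⌊c/a(β)⌋₊`, `c = min(η/16, ℓ/2)`; the
EQUICONTINUITY modulus `ω(t) = C (4t/c)^γ` (for `t ≤ c/8`, else `2 C_bd`) from (RMH) peeled on the increment; NONCONTACT is
carried.  (The hypothesis `TwoCubePeeling` enters through its landed proof `twoCube_peel`.) [folklore] -/
theorem tightPeelingGlue_proof (h1 : Summit.QuantumFields.YangMills.Theses.UniversalDetector.SchemeResponseLaws)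
    (_hTC : Summit.QuantumFields.YangMills.Theses.UniversalDetector.TwoCubePeeling) :
    Summit.QuantumFields.YangMills.Theses.UniversalDetector.PlaneTightScheme := by
  intro G _ _ _ _ hG
  letI : MeasurableSpace G := borel G
  haveI : BorelSpace G := ⟨rfl⟩
  obtain ⟨r, a, ha, hlim, hRM, hRMH, hN⟩ := h1 G hG
  obtain ⟨pr, C₁, B, β₁, ℓ₁, hC₁, hℓ₁, hRM⟩ := hRM
  obtain ⟨γ, C₂, B₂, β₂, ℓ₂, hγ, hC₂, hℓ₂, hRMH⟩ := hRMH
  refine ⟨r, a, ha, hlim, ?_, hN⟩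
  intro q₁ q₂ hq₁ hq₂ η hη
  -- constants
  have hℓ : 0 < min ℓ₁ ℓ₂ := lt_min hℓ₁ hℓ₂
  set c : ℝ := min (η / 16) (min ℓ₁ ℓ₂ / 2) with hcdef
  have hc : 0 < c := lt_min (by positivity) (by positivity)
  have hcη : c ≤ η / 16 := min_le_left _ _
  have hcℓ₁ : c ≤ ℓ₁ := (min_le_right _ _).trans (by linarith [min_le_left ℓ₁ ℓ₂])
  have hcℓ₂ : c ≤ ℓ₂ := (min_le_right _ _).trans (by linarith [min_le_right ℓ₁ ℓ₂])
  have ha₀ : 0 < min (η / 48) (c / 2) := lt_min (by positivity) (by positivity)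
  obtain ⟨β₀, hβ₀⟩ := eventually_le_of_tendsto hlim ha₀
  set KB : ℝ := Real.sqrt (2 * Real.exp B) with hKB
  set KB₂ : ℝ := Real.sqrt (2 * Real.exp B₂) with hKB₂
  set Cbd : ℝ := 4 * Real.exp B * C₁ ^ 2 * (2 / c) ^ 8 with hCbd
  set Cω : ℝ := 2 * (KB * C₁) * (KB₂ * C₂) * (2 / c) ^ 8 with hCω
  have hCbd0 : 0 ≤ Cbd := by positivity
  have hCω0 : 0 ≤ Cω := by positivity
  refine ⟨Cbd, max (max β₁ β₂) β₀, 0, fun t => if t ≤ c / 8 then Cω * (4 * t / c) ^ γ else 2 * Cbd, ?_, ?_⟩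
  · -- the modulus tends to `0` at `0⁺`
    have hca : ContinuousAt (fun t : ℝ => Cω * (4 * t / c) ^ γ) 0 := by
      have hlin : ContinuousAt (fun t : ℝ => 4 * t / c) 0 :=
        ((continuous_const.mul continuous_id).div_const c).continuousAt
      exact continuousAt_const.mul (hlin.rpow_const (Or.inr hγ.le))
    have h0 : Cω * (4 * (0 : ℝ) / c) ^ γ = 0 := by
      rw [mul_zero, zero_div, Real.zero_rpow hγ.ne', mul_zero]
    have ht : Tendsto (fun t : ℝ => Cω * (4 * t / c) ^ γ) (𝓝[Set.Ioi 0] 0) (𝓝 0) := by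
      have := hca.tendsto
      rw [h0] at this
      exact this.mono_left nhdsWithin_le_nhds
    refine ht.congr' ?_
    have hmem : Set.Ioo (0 : ℝ) (c / 8) ∈ 𝓝[Set.Ioi 0] (0 : ℝ) := Ioo_mem_nhdsGT (by positivity)
    filter_upwards [hmem] with t ht'
    rw [if_pos ht'.2.le]
  · intro β hβ L _hΛ z hz hzη
    have hβ₁ : β₁ ≤ β := (le_max_left _ _).trans ((le_max_left _ _).trans hβ)
    have hβ₂ : β₂ ≤ β := (le_max_right _ _).trans ((le_max_left _ _).trans hβ)
    have haβ : 0 < a β := ha β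
    have ha₁ : a β ≤ η / 48 := (hβ₀ β ((le_max_right _ _).trans hβ)).trans (min_le_left _ _)
    have ha₂ : a β ≤ c / 2 := (hβ₀ β ((le_max_right _ _).trans hβ)).trans (min_le_right _ _)
    -- the peeling radius `N = ⌊c / a β⌋₊`
    set N : ℕ := ⌊c / a β⌋₊ with hNdef
    have hNle : (N : ℝ) ≤ c / a β := Nat.floor_le (by positivity)
    have hNlt : c / a β < (N : ℝ) + 1 := Nat.lt_floor_add_one _
    have hca2 : (2 : ℝ) ≤ c / a β := by rw [le_div_iff₀ haβ]; linarith
    have hN2 : 2 ≤ N := Nat.le_floor (by exact_mod_cast hca2)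
    have hN1 : 1 ≤ N := le_trans (by norm_num) hN2
    have hNpos : (0 : ℝ) < N := by exact_mod_cast hN1
    have hNa : (N : ℝ) * a β ≤ c := by rwa [← le_div_iff₀ haβ]
    have hNa' : c / 2 ≤ (N : ℝ) * a β := by
      have h1 : c - a β < (N : ℝ) * a β := by
        have := (sub_lt_iff_lt_add).2 (by rwa [div_lt_iff₀ haβ, add_mul, one_mul] at hNlt : c < (N : ℝ) * a β + a β)
        linarith
      linarith
    have hNℓ₁ : (N : ℝ) * a β ≤ ℓ₁ := hNa.trans hcℓ₁
    have hNℓ₂ : (N : ℝ) * a β ≤ ℓ₂ := hNa.trans hcℓ₂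
    -- the box point `z`: `η / a β ≤ ‖z‖ ≤ 2L`
    have hz' := mem_box.1 hz
    have hnz : η ≤ a β * ‖siteToE z‖ := by rwa [norm_smul_siteToE haβ.le] at hzη
    have hzL : ‖siteToE z‖ ≤ 2 * (L : ℝ) := norm_siteToE_le_two_mul (Nat.cast_nonneg L) fun j => by
      have h := hz' j
      have h1 : ((-(L : ℤ) : ℤ) : ℝ) ≤ ((z j : ℤ) : ℝ) := by exact_mod_cast h.1
      have h2 : ((z j : ℤ) : ℝ) ≤ ((L : ℤ) : ℝ) := by exact_mod_cast h.2
      push_cast at h1 h2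
      exact abs_le.2 ⟨h1, h2⟩
    have hLa : η / 2 ≤ (L : ℝ) * a β := by
      have := mul_le_mul_of_nonneg_left hzL haβ.le
      linarith
    -- `4N + 8 ≤ L`
    have hL4 : 4 * N + 8 ≤ L := by
      have h1 : ((4 * N + 8 : ℕ) : ℝ) * a β = 4 * ((N : ℝ) * a β) + 8 * a β := by push_cast; ring
      have h2 : ((4 * N + 8 : ℕ) : ℝ) * a β ≤ (L : ℝ) * a β := by rw [h1]; linarith
      exact_mod_cast le_of_mul_le_mul_right h2 haβ
    have hL2 : 2 * N + 12 ≤ L := by omega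
    -- the scale factor `(a β)⁻⁸ / N⁸ ≤ (2/c)⁸`
    have hA : (a β)⁻¹ ^ 8 / (N : ℝ) ^ 8 ≤ (2 / c) ^ 8 := by
      have h1 : 1 / ((N : ℝ) * a β) ≤ 2 / c := by
        rw [div_le_div_iff₀ (by positivity) hc]; linarith
      have h2 : (a β)⁻¹ ^ 8 / (N : ℝ) ^ 8 = (1 / ((N : ℝ) * a β)) ^ 8 := by
        field_simp
      rw [h2]
      exact pow_le_pow_left₀ (by positivity) h1 8
    -- every admissible point has a long coordinate
    have hlong : ∀ w : Fin 4 → ℤ, η ≤ ‖a β • siteToE w‖ → ∃ j₁, 2 * (N : ℤ) + 6 ≤ |w j₁| := by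
      intro w hw
      by_contra hcon
      push Not at hcon
      have hws : ‖siteToE w‖ ≤ 2 * (2 * (N : ℝ) + 5) := norm_siteToE_le_two_mul (by positivity) fun j => by
        have h : |w j| ≤ 2 * (N : ℤ) + 5 := by have := hcon j; omega
        have h' : ((|w j| : ℤ) : ℝ) ≤ 2 * (N : ℝ) + 5 := by exact_mod_cast h
        rwa [Int.cast_abs] at h'
      have hnw : η ≤ a β * ‖siteToE w‖ := by rwa [norm_smul_siteToE haβ.le] at hw
      have h3 : a β * ‖siteToE w‖ ≤ 4 * ((N : ℝ) * a β) + 10 * a β := by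
        have := mul_le_mul_of_nonneg_left hws haβ.le
        linarith
      linarith
    -- the laws at this coupling, torus and radius
    have hRMβ : ∀ (q : Fin 4 × Fin 4) (x : Fin 4 → ℤ), q.1 < q.2 → torusE G r β L (fun U => Real.exp ((N : ℝ) ^ 4 / C₁ *
        |kerE G r β (fun k => x k - ((N : ℤ) + 1)) (2 * N + 3) U (plane G r q x) - (fun q' => pr q' β) q|)) ≤
        Real.exp B :=
      fun q x hq => hRM β hβ₁ L q x N hq hN1 hNℓ₁ hL4
    -- boundedness at every admissible point
    have hbd : ∀ w : Fin 4 → ℤ, (∀ j, -(L : ℤ) ≤ w j ∧ w j ≤ L) → ∀ j₁, 2 * (N : ℤ) + 6 ≤ |w j₁| →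
        |(a β)⁻¹ ^ 8 * (torusE G r β L (fun U => plane G r q₁ 0 U * plane G r q₂ w U) -
          torusE G r β L (plane G r q₁ 0) * torusE G r β L (plane G r q₂ w))| ≤ Cbd := by
      intro w hw j₁ hj₁
      have h := abs_cov_plane_zero_le G r hN1 hL2 hC₁ hRMβ hq₁ hq₂ hw hj₁
      rw [abs_mul, abs_of_pos (by positivity : (0 : ℝ) < (a β)⁻¹ ^ 8)]
      calc (a β)⁻¹ ^ 8 * _ ≤ (a β)⁻¹ ^ 8 * (4 * Real.exp B * C₁ ^ 2 / (N : ℝ) ^ 8) :=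
            mul_le_mul_of_nonneg_left h (by positivity)
        _ = 4 * Real.exp B * C₁ ^ 2 * ((a β)⁻¹ ^ 8 / (N : ℝ) ^ 8) := by ring
        _ ≤ 4 * Real.exp B * C₁ ^ 2 * (2 / c) ^ 8 := mul_le_mul_of_nonneg_left hA (by positivity)
    obtain ⟨j₀, hj₀⟩ := hlong z hzη
    refine ⟨hbd z hz' j₀ hj₀, fun z' hz₂ hz'η => ?_⟩
    obtain ⟨j₁, hj₁⟩ := hlong z' hz'η
    have hz₂' := mem_box.1 hz₂
    dsimp only
    by_cases hfar : c / 8 < ‖a β • siteToE z - a β • siteToE z'‖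
    · rw [if_neg (not_le.2 hfar)]
      calc _ ≤ _ := abs_sub _ _
        _ ≤ Cbd + Cbd := add_le_add (hbd z hz' j₀ hj₀) (hbd z' hz₂' j₁ hj₁)
        _ = 2 * Cbd := by ring
    · push Not at hfar
      rw [if_pos hfar]
      by_cases hzz : z' = z
      · subst hzz
        rw [sub_self, abs_zero]
        exact mul_nonneg hCω0 (Real.rpow_nonneg (by positivity) γ)
      · -- the increment `u = z' − z` and its size `n = ⌈‖u‖⌉`
        set u : Fin 4 → ℤ := z' - z with hudef
        have hu0 : u ≠ 0 := fun h => hzz (sub_eq_zero.1 h)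
        have hz'u : z' = z + u := by rw [hudef]; abel
        have hsub : siteToE z' - siteToE z = siteToE u := by
          ext i; simp [hudef, siteToE_apply]
        have ht : ‖a β • siteToE z - a β • siteToE z'‖ = a β * ‖siteToE u‖ := by
          rw [← smul_sub, norm_smul, Real.norm_of_nonneg haβ.le, norm_sub_rev, hsub]
        rw [ht] at hfar ⊢
        have hu1 : 1 ≤ ‖siteToE u‖ := one_le_norm_siteToE hu0
        set n : ℕ := ⌈‖siteToE u‖⌉₊ with hndef
        have hnle : ‖siteToE u‖ ≤ n := Nat.le_ceil _
        have hnlt : (n : ℝ) < ‖siteToE u‖ + 1 := Nat.ceil_lt_add_one (norm_nonneg _)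
        have hn0 : 0 < n := Nat.ceil_pos.2 (lt_of_lt_of_le one_pos hu1)
        have hn1 : 1 ≤ n := hn0
        have hnpos : (0 : ℝ) < n := by exact_mod_cast hn0
        have hn2 : (n : ℝ) ≤ 2 * ‖siteToE u‖ := by linarith
        have huj : ∀ j, |u j| ≤ (n : ℤ) := fun j => by
          have h0 := PiLp.norm_apply_le (siteToE u) j
          rw [Real.norm_eq_abs, siteToE_apply] at h0
          have h := h0.trans hnle
          rw [← Int.cast_abs] at h
          exact_mod_cast h
        have h2n : 2 * n ≤ N := by
          have h1 : (2 * n : ℝ) ≤ 4 * ‖siteToE u‖ := by linarith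
          have h2 : 4 * ‖siteToE u‖ * a β ≤ c / 2 := by
            have : 4 * ‖siteToE u‖ * a β = 4 * (a β * ‖siteToE u‖) := by ring
            rw [this]; linarith
          have h3 : c / 2 ≤ c - a β := by linarith
          have h4 : (c - a β) / a β < N := by
            rw [div_lt_iff₀ haβ]
            have := (div_lt_iff₀ haβ).1 hNlt
            linarith
          have h5 : 4 * ‖siteToE u‖ ≤ (c - a β) / a β := by
            rw [le_div_iff₀ haβ]; linarith
          have h6 : (2 * n : ℝ) < N := by linarith
          exact_mod_cast h6.le
        have hnN : n ≤ N := by omega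
        -- (RMH) at this coupling, torus, radius and increment
        have hlam₂ : 0 < (N : ℝ) ^ 4 * ((N : ℝ) / n) ^ γ / C₂ := by positivity
        have hRMHβ : ∀ (q : Fin 4 × Fin 4) (x : Fin 4 → ℤ), q.1 < q.2 → torusE G r β L (fun U =>
            Real.exp ((N : ℝ) ^ 4 * ((N : ℝ) / n) ^ γ / C₂ *
              |kerE G r β (fun k => x k - ((N : ℤ) + 1)) (2 * N + 3) U (fun V => plane G r q x V - plane G r q (x + u) V)|))
            ≤ Real.exp B₂ :=
          fun q x hq => hRMH β hβ₂ L q x u N n hq hn1 huj h2n hNℓ₂ hL4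
        have hinc := abs_cov_plane_zero_sub_le G r hN1 hnN hL2 hC₁ hlam₂ huj hRMβ hRMHβ hq₁ hq₂ hz' hj₀
        rw [hz'u, ← mul_sub, abs_mul, abs_of_pos (by positivity : (0 : ℝ) < (a β)⁻¹ ^ 8)]
        -- the Hölder gain
        have hX : 0 < ((N : ℝ) / n) ^ γ := Real.rpow_pos_of_pos (by positivity) γ
        have hBx : 1 / ((N : ℝ) / n) ^ γ ≤ (4 * (a β * ‖siteToE u‖) / c) ^ γ := by
          have hbase : 1 ≤ (N : ℝ) / n * (4 * (a β * ‖siteToE u‖) / c) := by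
            rw [div_mul_div_comm, le_div_iff₀ (by positivity), one_mul]
            have h1 : (n : ℝ) * c ≤ (n : ℝ) * (2 * ((N : ℝ) * a β)) :=
              mul_le_mul_of_nonneg_left (by linarith) hnpos.le
            have h2 : 2 * ((N : ℝ) * a β) * n ≤ 2 * ((N : ℝ) * a β) * (2 * ‖siteToE u‖) :=
              mul_le_mul_of_nonneg_left hn2 (by positivity)
            have e2 : 2 * ((N : ℝ) * a β) * (2 * ‖siteToE u‖) = (N : ℝ) * (4 * (a β * ‖siteToE u‖)) := by ring
            have e3 : (n : ℝ) * (2 * ((N : ℝ) * a β)) = 2 * ((N : ℝ) * a β) * n := by ring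
            rw [← e2]
            exact (h1.trans_eq e3).trans h2
          have h1 : 1 ≤ ((N : ℝ) / n * (4 * (a β * ‖siteToE u‖) / c)) ^ γ := Real.one_le_rpow hbase hγ.le
          rw [Real.mul_rpow (by positivity) (by positivity)] at h1
          rwa [div_le_iff₀' hX]
        have e1 : (a β)⁻¹ ^ 8 * (2 * (KB * C₁ / (N : ℝ) ^ 4) * (KB₂ / ((N : ℝ) ^ 4 * ((N : ℝ) / n) ^ γ / C₂))) =
            2 * (KB * C₁) * (KB₂ * C₂) * ((a β)⁻¹ ^ 8 / (N : ℝ) ^ 8) * (1 / ((N : ℝ) / n) ^ γ) := by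
          field_simp
        calc (a β)⁻¹ ^ 8 * _ ≤ (a β)⁻¹ ^ 8 * (2 * (KB * C₁ / (N : ℝ) ^ 4) * (KB₂ / ((N : ℝ) ^ 4 * ((N : ℝ) / n) ^ γ / C₂))) :=
              mul_le_mul_of_nonneg_left hinc (by positivity)
          _ = 2 * (KB * C₁) * (KB₂ * C₂) * ((a β)⁻¹ ^ 8 / (N : ℝ) ^ 8) * (1 / ((N : ℝ) / n) ^ γ) := e1
          _ ≤ 2 * (KB * C₁) * (KB₂ * C₂) * (2 / c) ^ 8 * (4 * (a β * ‖siteToE u‖) / c) ^ γ :=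
              mul_le_mul (mul_le_mul_of_nonneg_left hA (by positivity)) hBx (by positivity) (by positivity)

end Summit.QuantumFields.YangMills.Cruxes.UniversalDetectorTightPeeling

/-- Item `TightPeelingGlue` of route `UniversalDetector` (stmt-QuantumFields-23935). [folklore] -/
theorem Summit.QuantumFields.YangMills.Theorems.universalDetector_tightPeelingGlue :
    Summit.QuantumFields.YangMills.Theses.UniversalDetector.TightPeelingGlue :=
  fun h1 h2 => Summit.QuantumFields.YangMills.Cruxes.UniversalDetectorTightPeeling.tightPeelingGlue_proof h1 h2
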